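import Mathlib.CategoryTheory.Endomorphism
import Literature.AlgebraicGeometry.Frobenioids.CategoriesFactorization
import Literature.AlgebraicGeometry.Frobenioids.ArchimedeanBaseCategory
import HarnessLib

/-!
# A four-object base category over `D₀`, of RC-standard type, at which [FrdII] Proposition 3.5 (iii) fails
# for `N` (input of the kernel counterexample; the RC-STANDARD strengthening of finding P35iii-F1)

Mochizuki, *The geometry of Frobenioids II: poly-Frobenioids*, Kyushu J. Math. **62** (2008) 401–460, §3,
Definition 3.1 (v) p. 25 («RC-standard type»), Proposition 3.5 (iii) p. 34 («`N` is of RC-iso-subanchor type»),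
Corollary 4.2 (v) (journal p. 437: "If `D_i` is of RC-standard type, then so is `G_i` [`= N_i`, `R_i`]", proved
"formally from Proposition 3.4 (viii) and 3.5 (iii)") [cite: MochizukiFrdII2008, Prop 3.5 (iii) p.34], and [FrdI] §0
p. 18 (categorical quotients, mono-minimality) [cite: MochizukiFrdI2008, §0 p.18].

This file (abc-iut cell, layer L1, node `FrdII:Prop3.5(iii)`, sub-row P35iii-STD; seat abc-iut-w4-d027 gen 3) builds
the TOY BASE CATEGORY `S` used by `ArchimedeanProp35iiiStdCounterexample.lean`, in the style of abc-iut-w5-d013's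
two-object base `T` (`ArchimedeanProp35iToyBase.lean`):

* objects `a` (↦ `Spec ℝ`), `b`, `c`, `d` (↦ `Spec ℂ`); `Aut(b) = {1, σ}` with the ONE arrow `f : b → a` fixed by
  `σ` (the `T`-mechanism: the base functor KILLS `σ`); `Aut(c) = {1, β}` with TWO distinct arrows `h, h′ : c → a`
  both fixed by `β` (the base functor sends `β` to complex conjugation — so `c → a` «complexifies» `a` — but neither
  `h` nor `h′` is a categorical quotient); `d` with `Aut(d) = 1` and arrows `p, pσ : d → b`, `q, qβ : d → c`,
  `pf, qh, qh′ : d → a` (it only serves to make `S[ℂ]` connected); `End(a) = 1`; no other arrows;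
* PROVED here: `S` is a category; its hom-sets (`Hom(b, a) = {f}`, `End(a) = End(d) = 1`, the empty ones);
  `σ`, `β` as isomorphisms; `h ≠ h′`, `p ≠ pσ`, `q ≠ qβ`; DEFINED: the base functor `toD0 : S ⥤ D₀` (`a ↦ Spec ℝ`;
  `b, c, d ↦ Spec ℂ`; `σ ↦ 𝟙` — the functor KILLS `Aut(b)` —, `β ↦` conjugation, `p, pσ ↦ 𝟙`, `q ≫ β^t ↦ gal t`,
  arrows to `a ↦ Spec ℂ → Spec ℝ`). The proof-only companion `ArchimedeanProp35iiiStdProps.lean` proves that `S` is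
  connected, totally epimorphic, of FSM-type, and that `f : b → a` is a mono-minimal categorical quotient of `b` by
  `Aut(b)` ([FrdI] §0); `…StdBaseRC.lean` that `(S, toD0)` is of RC-standard type.

Everything is finite and proved by case analysis; no `Prop`-valued fact is introduced. RC-standard type of
`(S, toD0)` and the failure of Prop. 3.5 (iii) for `N` over it are in the proof-only companions. Nothing here bears
on [IUTchIII] Cor. 3.12; typed ≠ proved.
-/

namespace Literature.AlgebraicGeometry.Frobenioids

open CategoryTheory

noncomputable section

namespace ArchFrd

namespace P35iiiStd

/-! ### The base category `S` -/

/-- The objects: `a` (real) and `b`, `c`, `d` (complex). [cite: MochizukiFrdII2008, Prop 3.5 (iii) p.34] -/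
inductive S : Type
  /-- the real object, a quotient of `b` by a group the base functor kills -/
  | a
  /-- the complex object with `Aut = {1, σ}` -/
  | b
  /-- the complex object with `Aut = {1, β}`, `β ↦` conjugation, and two arrows to `a` -/
  | c
  /-- the complex object connecting `b` and `c` inside `S[ℂ]` -/
  | d
  deriving DecidableEq, Inhabited

namespace S

/-- Labels of the three arrows `d → a`: `p ≫ f` and `q ≫ h_k` (`k = false, true`).
[cite: MochizukiFrdII2008, Prop 3.5 (iii) p.34] -/
inductive R : Type
  /-- the composite `d → b → a` -/
  | pf
  /-- the composites `d → c → a` through `h_false = h`, `h_true = h′` -/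
  | qh (k : Bool)
  deriving DecidableEq

/-- Morphisms of `S`. [cite: MochizukiFrdII2008, Prop 3.5 (iii) p.34] -/
inductive Hom : S → S → Type
  /-- `σ^s ∈ Aut(b)` -/
  | autB (s : Bool) : Hom b b
  /-- `β^t ∈ Aut(c)` -/
  | autC (t : Bool) : Hom c c
  /-- the identity of `a` (`End(a) = 1`) -/
  | ida : Hom a a
  /-- the identity of `d` (`End(d) = 1`) -/
  | idd : Hom d d
  /-- the quotient arrow `f : b → a` -/
  | f : Hom b a
  /-- the two arrows `h = h_false`, `h′ = h_true : c → a` -/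
  | h (k : Bool) : Hom c a
  /-- the arrows `p ≫ σ^s : d → b` -/
  | p (s : Bool) : Hom d b
  /-- the arrows `q ≫ β^t : d → c` -/
  | q (t : Bool) : Hom d c
  /-- the three arrows `d → a` -/
  | r (ρ : R) : Hom d a
  deriving DecidableEq

/-- Composition (diagrammatic order). [cite: MochizukiFrdII2008, Prop 3.5 (iii) p.34] -/
def Hom.comp : {X Y Z : S} → Hom X Y → Hom Y Z → Hom X Z
  | _, _, _, .autB s, .autB s' => .autB (xor s s')
  | _, _, _, .autB _, .f => .f
  | _, _, _, .autC t, .autC t' => .autC (xor t t')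
  | _, _, _, .autC _, .h k => .h k
  | _, _, _, .ida, .ida => .ida
  | _, _, _, .f, .ida => .f
  | _, _, _, .h k, .ida => .h k
  | _, _, _, .idd, .idd => .idd
  | _, _, _, .idd, .p s => .p s
  | _, _, _, .idd, .q t => .q t
  | _, _, _, .idd, .r ρ => .r ρ
  | _, _, _, .p s, .autB s' => .p (xor s s')
  | _, _, _, .p _, .f => .r .pf
  | _, _, _, .q t, .autC t' => .q (xor t t')
  | _, _, _, .q _, .h k => .r (.qh k)
  | _, _, _, .r ρ, .ida => .r ρ

/-- Identities. [cite: MochizukiFrdII2008, Prop 3.5 (iii) p.34] -/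
def Hom.id : (X : S) → Hom X X
  | .a => .ida
  | .b => .autB false
  | .c => .autC false
  | .d => .idd

/-- `S` is a category (laws by cases on the finitely many arrows). [cite: MochizukiFrdII2008, Prop 3.5 (iii) p.34] -/
instance instCategory : Category S where
  Hom := Hom
  id := Hom.id
  comp := Hom.comp
  id_comp φ := by cases φ <;> first | rfl | simp only [Hom.id, Hom.comp, Bool.false_xor]
  comp_id φ := by cases φ <;> first | rfl | simp only [Hom.id, Hom.comp, Bool.xor_false]
  assoc φ ψ χ := by cases φ <;> cases ψ <;> cases χ <;> first | rfl | simp only [Hom.comp, Bool.xor_assoc]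

/-! ### Named arrows and hom-set lemmas -/

/-- `σ^s ∈ Aut(b)` as an arrow of `S`. [cite: MochizukiFrdII2008, Prop 3.5 (iii) p.34] -/
def au (s : Bool) : b ⟶ b := Hom.autB s

/-- `β^t ∈ Aut(c)` as an arrow of `S`. [cite: MochizukiFrdII2008, Prop 3.5 (iii) p.34] -/
def cu (t : Bool) : c ⟶ c := Hom.autC t

/-- The quotient arrow `f : b → a`. [cite: MochizukiFrdII2008, Prop 3.5 (iii) p.34] -/
def fHom : b ⟶ a := Hom.f

/-- The arrows `h_k : c → a` (`h = h_false`, `h′ = h_true`). [cite: MochizukiFrdII2008, Prop 3.5 (iii) p.34] -/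
def hHom (k : Bool) : c ⟶ a := Hom.h k

/-- The arrows `p ≫ σ^s : d → b`. [cite: MochizukiFrdII2008, Prop 3.5 (iii) p.34] -/
def pHom (s : Bool) : d ⟶ b := Hom.p s

/-- The arrows `q ≫ β^t : d → c`. [cite: MochizukiFrdII2008, Prop 3.5 (iii) p.34] -/
def qHom (t : Bool) : d ⟶ c := Hom.q t

/-- Every arrow `b → b` is some `σ^s`. [cite: MochizukiFrdII2008, Prop 3.5 (iii) p.34] -/
theorem hom_bb_eq (φ : b ⟶ b) : ∃ s : Bool, φ = au s := by
  cases φ with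
  | autB s => exact ⟨s, rfl⟩

/-- Every arrow `c → c` is some `β^t`. [cite: MochizukiFrdII2008, Prop 3.5 (iii) p.34] -/
theorem hom_cc_eq (φ : c ⟶ c) : ∃ t : Bool, φ = cu t := by
  cases φ with
  | autC t => exact ⟨t, rfl⟩

/-- Every arrow `c → a` is some `h_k`. [cite: MochizukiFrdII2008, Prop 3.5 (iii) p.34] -/
theorem hom_ca_eq (φ : c ⟶ a) : ∃ k : Bool, φ = hHom k := by
  cases φ with
  | h k => exact ⟨k, rfl⟩

/-- Every arrow `d → b` is some `p ≫ σ^s`. [cite: MochizukiFrdII2008, Prop 3.5 (iii) p.34] -/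
theorem hom_db_eq (φ : d ⟶ b) : ∃ s : Bool, φ = pHom s := by
  cases φ with
  | p s => exact ⟨s, rfl⟩

/-- Every arrow `d → c` is some `q ≫ β^t`. [cite: MochizukiFrdII2008, Prop 3.5 (iii) p.34] -/
theorem hom_dc_eq (φ : d ⟶ c) : ∃ t : Bool, φ = qHom t := by
  cases φ with
  | q t => exact ⟨t, rfl⟩

/-- `Hom(b, a) = {f}`. [cite: MochizukiFrdII2008, Prop 3.5 (iii) p.34] -/
instance subsingleton_hom_ba : Subsingleton (b ⟶ a) := ⟨fun φ ψ => by cases φ; cases ψ; rfl⟩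

/-- `End(a) = {1}`. [cite: MochizukiFrdII2008, Prop 3.5 (iii) p.34] -/
instance subsingleton_hom_aa : Subsingleton (a ⟶ a) := ⟨fun φ ψ => by cases φ; cases ψ; rfl⟩

/-- `End(d) = {1}`. [cite: MochizukiFrdII2008, Prop 3.5 (iii) p.34] -/
instance subsingleton_hom_dd : Subsingleton (d ⟶ d) := ⟨fun φ ψ => by cases φ; cases ψ; rfl⟩

/-- `Hom(a, b) = ∅`. [cite: MochizukiFrdII2008, Prop 3.5 (iii) p.34] -/
instance isEmpty_hom_ab : IsEmpty (a ⟶ b) := ⟨fun φ => by cases φ⟩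

/-- `Hom(a, c) = ∅`. [cite: MochizukiFrdII2008, Prop 3.5 (iii) p.34] -/
instance isEmpty_hom_ac : IsEmpty (a ⟶ c) := ⟨fun φ => by cases φ⟩

/-- `Hom(a, d) = ∅`. [cite: MochizukiFrdII2008, Prop 3.5 (iii) p.34] -/
instance isEmpty_hom_ad : IsEmpty (a ⟶ d) := ⟨fun φ => by cases φ⟩

/-- `Hom(b, c) = ∅`. [cite: MochizukiFrdII2008, Prop 3.5 (iii) p.34] -/
instance isEmpty_hom_bc : IsEmpty (b ⟶ c) := ⟨fun φ => by cases φ⟩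

/-- `Hom(b, d) = ∅`. [cite: MochizukiFrdII2008, Prop 3.5 (iii) p.34] -/
instance isEmpty_hom_bd : IsEmpty (b ⟶ d) := ⟨fun φ => by cases φ⟩

/-- `Hom(c, b) = ∅`. [cite: MochizukiFrdII2008, Prop 3.5 (iii) p.34] -/
instance isEmpty_hom_cb : IsEmpty (c ⟶ b) := ⟨fun φ => by cases φ⟩

/-- `Hom(c, d) = ∅`. [cite: MochizukiFrdII2008, Prop 3.5 (iii) p.34] -/
instance isEmpty_hom_cd : IsEmpty (c ⟶ d) := ⟨fun φ => by cases φ⟩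

/-- Composition of automorphisms of `b` adds the bits. [cite: MochizukiFrdII2008, Prop 3.5 (iii) p.34] -/
@[simp] theorem au_comp_au (s s' : Bool) : au s ≫ au s' = au (xor s s') := rfl

/-- `Aut(b)` fixes `f`. [cite: MochizukiFrdII2008, Prop 3.5 (iii) p.34] -/
@[simp] theorem au_comp_fHom (s : Bool) : au s ≫ fHom = fHom := rfl

/-- Composition of automorphisms of `c` adds the bits. [cite: MochizukiFrdII2008, Prop 3.5 (iii) p.34] -/
@[simp] theorem cu_comp_cu (t t' : Bool) : cu t ≫ cu t' = cu (xor t t') := rfl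

/-- `Aut(c)` fixes `h` and `h′`. [cite: MochizukiFrdII2008, Prop 3.5 (iii) p.34] -/
@[simp] theorem cu_comp_hHom (t k : Bool) : cu t ≫ hHom k = hHom k := rfl

/-- More generally every endomorphism of `c` fixes every arrow `c → a`. [cite: MochizukiFrdII2008, Prop 3.5 (iii) p.34] -/
theorem endo_comp_hom_ca (e : c ⟶ c) (x : c ⟶ a) : e ≫ x = x := by
  obtain ⟨t, rfl⟩ := hom_cc_eq e
  obtain ⟨k, rfl⟩ := hom_ca_eq x
  rfl

/-- `p ≫ σ^s ≫ σ^{s'} = p ≫ σ^{s + s'}`. [cite: MochizukiFrdII2008, Prop 3.5 (iii) p.34] -/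
@[simp] theorem pHom_comp_au (s s' : Bool) : pHom s ≫ au s' = pHom (xor s s') := rfl

/-- `q ≫ β^t ≫ β^{t'} = q ≫ β^{t + t'}`. [cite: MochizukiFrdII2008, Prop 3.5 (iii) p.34] -/
@[simp] theorem qHom_comp_cu (t t' : Bool) : qHom t ≫ cu t' = qHom (xor t t') := rfl

/-- The identity of `b` is `σ⁰`. [cite: MochizukiFrdII2008, Prop 3.5 (iii) p.34] -/
theorem id_b : (𝟙 b : b ⟶ b) = au false := rfl

/-- The identity of `c` is `β⁰`. [cite: MochizukiFrdII2008, Prop 3.5 (iii) p.34] -/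
theorem id_c : (𝟙 c : c ⟶ c) = cu false := rfl

/-- `h ≠ h′`. [cite: MochizukiFrdII2008, Prop 3.5 (iii) p.34] -/
theorem hHom_false_ne_true : hHom false ≠ hHom true := by
  intro e
  cases e

/-- `p ≠ p ≫ σ`. [cite: MochizukiFrdII2008, Prop 3.5 (iii) p.34] -/
theorem pHom_false_ne_true : pHom false ≠ pHom true := by
  intro e
  cases e

/-- `q ≠ q ≫ β`. [cite: MochizukiFrdII2008, Prop 3.5 (iii) p.34] -/
theorem qHom_false_ne_true : qHom false ≠ qHom true := by
  intro e
  cases e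

/-- `σ^s` as an isomorphism (its own inverse). [cite: MochizukiFrdII2008, Prop 3.5 (iii) p.34] -/
def auIso (s : Bool) : b ≅ b where
  hom := au s
  inv := au s
  hom_inv_id := by rw [au_comp_au, Bool.xor_self, id_b]
  inv_hom_id := by rw [au_comp_au, Bool.xor_self, id_b]

/-- `β^t` as an isomorphism (its own inverse). [cite: MochizukiFrdII2008, Prop 3.5 (iii) p.34] -/
def cuIso (t : Bool) : c ≅ c where
  hom := cu t
  inv := cu t
  hom_inv_id := by rw [cu_comp_cu, Bool.xor_self, id_c]
  inv_hom_id := by rw [cu_comp_cu, Bool.xor_self, id_c]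

/-- `σ`, the nontrivial automorphism of `b` (KILLED by the base functor). [cite: MochizukiFrdII2008, Prop 3.5 (iii) p.34] -/
def sigma : b ≅ b := auIso true

/-- `β`, the nontrivial automorphism of `c` (sent to complex conjugation). [cite: MochizukiFrdII2008, Prop 3.5 (iii) p.34] -/
def beta : c ≅ c := cuIso true

/-- `σ ≠ 1`. [cite: MochizukiFrdII2008, Prop 3.5 (iii) p.34] -/
theorem sigma_hom_ne_id : sigma.hom ≠ 𝟙 b := by
  intro e
  cases e

end S

open S

/-! ### The base functor `S → D₀` (kills `σ`; sends `β` to complex conjugation) -/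

/-- The object map: `a ↦ Spec ℝ`; `b, c, d ↦ Spec ℂ`. [cite: MochizukiFrdII2008, Prop 3.5 (iii) p.34] -/
def toD0Obj : S → D0
  | .a => .real
  | .b => .complex
  | .c => .complex
  | .d => .complex

/-- The arrow map: `σ^s ↦ 𝟙`, `β^t ↦` the Galois twist `t`, `p ≫ σ^s ↦ 𝟙`, `q ≫ β^t ↦` the twist `t`, every arrow
to `a ↦ Spec ℂ → Spec ℝ` (resp. `1_a ↦ 1`). [cite: MochizukiFrdII2008, Prop 3.5 (iii) p.34] -/
def toD0Map : {X Y : S} → (X ⟶ Y) → (toD0Obj X ⟶ toD0Obj Y)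
  | _, _, .autB _ => D0.Hom.gal false
  | _, _, .autC t => D0.Hom.gal t
  | _, _, .ida => D0.Hom.idReal
  | _, _, .idd => D0.Hom.gal false
  | _, _, .f => D0.Hom.toReal
  | _, _, .h _ => D0.Hom.toReal
  | _, _, .p _ => D0.Hom.gal false
  | _, _, .q t => D0.Hom.gal t
  | _, _, .r _ => D0.Hom.toReal

/-- The base functor `π := toD0 : S → D₀`. [cite: MochizukiFrdII2008, Prop 3.5 (iii) p.34] -/
def toD0 : S ⥤ D0 where
  obj := toD0Obj
  map := toD0Map
  map_id X := by cases X <;> rfl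
  map_comp φ ψ := by cases φ <;> cases ψ <;> first | rfl | (rename_i t; cases t <;> rfl)

/-- `π(a) = Spec ℝ`. [cite: MochizukiFrdII2008, Prop 3.5 (iii) p.34] -/
@[simp] theorem toD0_obj_a : toD0.obj a = D0.real := rfl

/-- `π(b) = Spec ℂ`. [cite: MochizukiFrdII2008, Prop 3.5 (iii) p.34] -/
@[simp] theorem toD0_obj_b : toD0.obj b = D0.complex := rfl

/-- `π(c) = Spec ℂ`. [cite: MochizukiFrdII2008, Prop 3.5 (iii) p.34] -/
@[simp] theorem toD0_obj_c : toD0.obj c = D0.complex := rfl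

/-- `π(d) = Spec ℂ`. [cite: MochizukiFrdII2008, Prop 3.5 (iii) p.34] -/
@[simp] theorem toD0_obj_d : toD0.obj d = D0.complex := rfl

/-- `π` KILLS `Aut(b)`: `π(σ^s) = 𝟙`. [cite: MochizukiFrdII2008, Prop 3.5 (iii) p.34] -/
@[simp] theorem toD0_map_au (s : Bool) : toD0.map (au s) = 𝟙 D0.complex := rfl

/-- `π(β^t) = gal t`; in particular `π(β)` is complex conjugation. [cite: MochizukiFrdII2008, Prop 3.5 (iii) p.34] -/
@[simp] theorem toD0_map_cu (t : Bool) : toD0.map (cu t) = D0.Hom.gal t := rfl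

/-- `π(β)` is complex conjugation. [cite: MochizukiFrdII2008, Prop 3.5 (iii) p.34] -/
theorem toD0_map_beta : toD0.map beta.hom = D0.conj := rfl

/-- Every endomorphism of `b` is killed by `π`. [cite: MochizukiFrdII2008, Prop 3.5 (iii) p.34] -/
theorem toD0_map_endo_b (e : b ⟶ b) : toD0.map e = 𝟙 D0.complex := by
  obtain ⟨s, rfl⟩ := hom_bb_eq e
  rfl

/-- Every endomorphism of `d` is the identity, hence mapped to `𝟙`. [cite: MochizukiFrdII2008, Prop 3.5 (iii) p.34] -/
theorem toD0_map_endo_d (e : d ⟶ d) : toD0.map e = 𝟙 D0.complex := by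
  have he : e = 𝟙 d := Subsingleton.elim _ _
  subst he
  rfl

/-- `π(h_k)` is the structure arrow `Spec ℂ → Spec ℝ`, the same for `k = false, true`.
[cite: MochizukiFrdII2008, Prop 3.5 (iii) p.34] -/
@[simp] theorem toD0_map_hHom (k : Bool) : toD0.map (hHom k) = D0.toRealHom := rfl

end P35iiiStd

end ArchFrd

end

end Literature.AlgebraicGeometry.Frobenioids
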